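import Summits.QuantumFields.BalabanUV.Beta.SaddleInverse
import Literature.MathematicalPhysics.QuantumFieldTheory.Balaban1983to89.Beta.Composition

/-!
# `BalabanUV.Beta.FP.RelInvCompression` — road «FP», row (T-INV) of ruling R-FP-51 (route T «periodise ∕ factorise SLICED ∕ de-periodise at
# finite j»), FINITE-DIMENSIONAL HALF: **A RELATIVE INVERSE COMPRESSES TO THE TWO-SIDED INVERSE OF THE LIVE BLOCK, HENCE THE SLICED KKT IS
# INVERTIBLE AND ITS LIVE CORNER IS THE RELATIVE INVERSE** (β sub-cell, BINDER-OWNERS row D1, road owner `b2b-balaban-beta-d1-p3`; D1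
# formalisation swarm leaf-03 gen 18, statement-first WORD W-d1leaf03g18-1 ∕ ADDENDUM A1)

HONEST FRAMING (cell contract, verbatim): «discharging `BetaPertH` makes Bałaban's UV stability UNCONDITIONAL — a real constructive-QFT
result; it is NOT the continuum limit and NOT the Clay problem.»  HONEST DEPENDENCY: continuum YM on T⁴ ⇐ BetaPertH ∧ nine spine
estimates (0/9 proved); BetaPertH ⇐ (D1) ∧ (D4) ∧ CAP+tail; G-an2-4 gates asym, D1 and NE2/3/4.
DERIVED cell leaf: [folklore] finite-dimensional linear algebra over a commutative ring (Mathlib matrices only — NO object of the cell, no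
statement of Bałaban's papers, no `[cite:]`, no `def`, no `Prop` fact).  §1: with the live ∕ dead coordinate split `l ⊕ d` and the
coordinate projector `E = fromBlocks 1 0 0 0` (the shape of the periodised `axEc`: identity on non-comb bonds ⊕ multipliers, zero on comb
bonds), the four relative-inverse rules `E⬝A = A`, `A⬝E = A`, `(A⬝𝕄)⬝E = E`, `(E⬝𝕄)⬝A = E` (the matrix form of
`ChartConjugationRelative.RelInv` ∕ `RelInvBorderedHessianStep` rules 1–4) say exactly: `A` is supported on the live block and its live
block is THE two-sided inverse of `𝕄.toBlocks₁₁`.  §2: junction with cap3's TREE PINNING `SaddleInverse` §TreePin — for a bordered Hessian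
`𝕄` the live block is `kOff`, the SLICED KKT (comb coordinates pinned by slice rows) is `kBig`, `isUnit_det_kBig_iff` ∕ `inv_kBig_apply`
transfer invertibility and the live corner of the inverse; so under the four rules the sliced KKT is invertible with live corner `A`, for
ARBITRARY comb blocks.  §3: the same in the road's currency `Beta.Composition.kkt H [Q; τ]` with `τ` the comb-COORDINATE slice rows
(`kkt_fromRows_coordSlice_eq_kBig`: it IS `kBig` with `C♭ = Cᵀ`).  WHAT IT IS FOR: (T-INV)'s torus instance = this file ∘ the periodised
rules ((T-PER)'s `per_comp`) ∘ one reindex.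
HONEST: discharges NO binder of row D1 by itself; NOT SDF, NOT D1, NOT `BetaPertH`, NOT continuum, NOT Clay.
Provenance: β sub-cell, unit beta-d1-formalise-leaf-03 gen 18, 2026-08-21 (v1); no existing file touched.
-/

namespace Summit.QuantumFields.BalabanUV.Beta.FP.RelInvCompression

open Matrix

variable {R : Type*} [CommRing R]
variable {l d : Type*} [Fintype l] [Fintype d] [DecidableEq l]

/-- [folklore] `A⬝E = A` and `E⬝A = A` force `A = fromBlocks A₁₁ 0 0 0`. -/
theorem eq_fromBlocks_of_proj {A : Matrix (l ⊕ d) (l ⊕ d) R}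
    (hAE : A * (fromBlocks 1 0 0 0 : Matrix (l ⊕ d) (l ⊕ d) R) = A)
    (hEA : (fromBlocks 1 0 0 0 : Matrix (l ⊕ d) (l ⊕ d) R) * A = A) :
    A = fromBlocks A.toBlocks₁₁ 0 0 0 := by
  have hA := (Matrix.fromBlocks_toBlocks A).symm
  rw [hA, fromBlocks_multiply] at hAE hEA
  simp only [Matrix.mul_one, Matrix.mul_zero, Matrix.one_mul, Matrix.zero_mul, add_zero, fromBlocks_inj] at hAE hEA
  obtain ⟨-, h12, -, h22⟩ := hAE
  obtain ⟨-, -, h21, -⟩ := hEA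
  conv_lhs => rw [hA]
  rw [← h12, ← h21, ← h22]

/-- **[folklore] A RELATIVE INVERSE COMPRESSES TO A TWO-SIDED INVERSE**: under the four rules `E⬝A = A = A⬝E`, `(A⬝𝕄)⬝E = E`,
`(E⬝𝕄)⬝A = E` for the coordinate projector `E = 1_l ⊕ 0_d`, the live blocks are mutual inverses:
`A₁₁ ⬝ 𝕄₁₁ = 1` and `𝕄₁₁ ⬝ A₁₁ = 1`. -/
theorem toBlocks₁₁_mul_eq_one_of_relInv {A M : Matrix (l ⊕ d) (l ⊕ d) R}
    (hEA : (fromBlocks 1 0 0 0 : Matrix (l ⊕ d) (l ⊕ d) R) * A = A)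
    (hAE : A * (fromBlocks 1 0 0 0 : Matrix (l ⊕ d) (l ⊕ d) R) = A)
    (hAME : A * M * (fromBlocks 1 0 0 0 : Matrix (l ⊕ d) (l ⊕ d) R) = (fromBlocks 1 0 0 0 : Matrix (l ⊕ d) (l ⊕ d) R))
    (hEMA : (fromBlocks 1 0 0 0 : Matrix (l ⊕ d) (l ⊕ d) R) * M * A = (fromBlocks 1 0 0 0 : Matrix (l ⊕ d) (l ⊕ d) R)) :
    A.toBlocks₁₁ * M.toBlocks₁₁ = 1 ∧ M.toBlocks₁₁ * A.toBlocks₁₁ = 1 := by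
  have hA := eq_fromBlocks_of_proj hAE hEA
  have hM := (Matrix.fromBlocks_toBlocks M).symm
  rw [hA, hM, fromBlocks_multiply, fromBlocks_multiply] at hAME hEMA
  simp only [Matrix.mul_one, Matrix.mul_zero, Matrix.one_mul, Matrix.zero_mul, add_zero, fromBlocks_inj] at hAME hEMA
  exact ⟨hAME.1, hEMA.1⟩

/-- [folklore] Hence the live block `𝕄₁₁` has a unit determinant … -/
theorem isUnit_det_toBlocks₁₁_of_relInv {A M : Matrix (l ⊕ d) (l ⊕ d) R}
    (hEA : (fromBlocks 1 0 0 0 : Matrix (l ⊕ d) (l ⊕ d) R) * A = A)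
    (hAE : A * (fromBlocks 1 0 0 0 : Matrix (l ⊕ d) (l ⊕ d) R) = A)
    (hAME : A * M * (fromBlocks 1 0 0 0 : Matrix (l ⊕ d) (l ⊕ d) R) = (fromBlocks 1 0 0 0 : Matrix (l ⊕ d) (l ⊕ d) R))
    (hEMA : (fromBlocks 1 0 0 0 : Matrix (l ⊕ d) (l ⊕ d) R) * M * A = (fromBlocks 1 0 0 0 : Matrix (l ⊕ d) (l ⊕ d) R)) :
    IsUnit M.toBlocks₁₁.det :=
  Matrix.isUnit_det_of_left_inverse (toBlocks₁₁_mul_eq_one_of_relInv hEA hAE hAME hEMA).1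

/-- [folklore] … and its inverse IS the live block of the relative inverse: `(𝕄₁₁)⁻¹ = A₁₁`. -/
theorem inv_toBlocks₁₁_of_relInv {A M : Matrix (l ⊕ d) (l ⊕ d) R}
    (hEA : (fromBlocks 1 0 0 0 : Matrix (l ⊕ d) (l ⊕ d) R) * A = A)
    (hAE : A * (fromBlocks 1 0 0 0 : Matrix (l ⊕ d) (l ⊕ d) R) = A)
    (hAME : A * M * (fromBlocks 1 0 0 0 : Matrix (l ⊕ d) (l ⊕ d) R) = (fromBlocks 1 0 0 0 : Matrix (l ⊕ d) (l ⊕ d) R))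
    (hEMA : (fromBlocks 1 0 0 0 : Matrix (l ⊕ d) (l ⊕ d) R) * M * A = (fromBlocks 1 0 0 0 : Matrix (l ⊕ d) (l ⊕ d) R)) :
    (M.toBlocks₁₁)⁻¹ = A.toBlocks₁₁ :=
  Matrix.inv_eq_left_inv (toBlocks₁₁_mul_eq_one_of_relInv hEA hAE hAME hEMA).1

/-- [folklore] Conversely the relative inverse is determined by the live block: `A = fromBlocks (𝕄₁₁)⁻¹ 0 0 0`. -/
theorem eq_fromBlocks_inv_of_relInv {A M : Matrix (l ⊕ d) (l ⊕ d) R}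
    (hEA : (fromBlocks 1 0 0 0 : Matrix (l ⊕ d) (l ⊕ d) R) * A = A)
    (hAE : A * (fromBlocks 1 0 0 0 : Matrix (l ⊕ d) (l ⊕ d) R) = A)
    (hAME : A * M * (fromBlocks 1 0 0 0 : Matrix (l ⊕ d) (l ⊕ d) R) = (fromBlocks 1 0 0 0 : Matrix (l ⊕ d) (l ⊕ d) R))
    (hEMA : (fromBlocks 1 0 0 0 : Matrix (l ⊕ d) (l ⊕ d) R) * M * A = (fromBlocks 1 0 0 0 : Matrix (l ⊕ d) (l ⊕ d) R)) :
    A = fromBlocks (M.toBlocks₁₁)⁻¹ 0 0 0 := by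
  rw [inv_toBlocks₁₁_of_relInv hEA hAE hAME hEMA]
  exact eq_fromBlocks_of_proj hAE hEA

/-! ## §2 Junction with the tree-pinning identity: RelInv rules ⟹ the SLICED KKT is invertible and its live corner is `A` -/

section Sliced

open Summit.QuantumFields.BalabanUV.Beta.SaddleInverse (kBig kOff regroup isUnit_det_kBig_iff inv_kBig_apply)

variable {o c t : Type*} [Fintype o] [Fintype c] [Fintype t] [DecidableEq o] [DecidableEq c] [DecidableEq t]

/-- **[folklore] (T-INV), FINITE-DIMENSIONAL FORM.**  Index the bordered Hessian `𝕄 = [[H, C♭], [C, 0]]` (`H = [[Aoo, Aot], [Ato, Att]]` on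
non-comb ⊕ comb bonds `o ⊕ t`, constraint rows `C = [Co | Ct]`, columns `C♭ = [Cof ; Ctf]`, multipliers `c`) in LIVE ⊕ DEAD coordinates
`(o ⊕ c) ⊕ t`: `𝕄 = fromBlocks (kOff Aoo Cof Co) (fromRows Aot Ct) (fromCols Ato Ctf) Att`, and let `E = fromBlocks 1 0 0 0` be the coordinate
projector (`1` on non-comb bonds ⊕ multipliers, `0` on comb bonds — the `per axEc` shape).  If `A` obeys the four relative-inverse rules
`E⬝A = A`, `A⬝E = A`, `(A⬝𝕄)⬝E = E`, `(E⬝𝕄)⬝A = E`, then: (a) the compressed bordered Hessian `kOff Aoo Cof Co` has a unit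
determinant; (b) its inverse IS `A`'s live block; (c) the SLICED KKT `kBig Aoo Aot Ato Att Cof Ctf Co Ct` (comb coordinates pinned by slice
rows, native indexing `(o ⊕ t) ⊕ (c ⊕ t)`) has a unit determinant; (d) the live corner of ITS inverse is read off `A` — for ARBITRARY comb
blocks `Aot Ato Att Ct Ctf`
(`SaddleInverse.isUnit_det_kBig_iff` ∕ `inv_kBig_apply`). -/
theorem sliced_kkt_of_relInv (Aoo : Matrix o o R) (Aot : Matrix o t R) (Ato : Matrix t o R) (Att : Matrix t t R)
    (Cof : Matrix o c R) (Ctf : Matrix t c R) (Co : Matrix c o R) (Ct : Matrix c t R) {A : Matrix ((o ⊕ c) ⊕ t) ((o ⊕ c) ⊕ t) R}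
    (hEA : fromBlocks (1 : Matrix (o ⊕ c) (o ⊕ c) R) 0 0 (0 : Matrix t t R) * A = A)
    (hAE : A * fromBlocks (1 : Matrix (o ⊕ c) (o ⊕ c) R) 0 0 (0 : Matrix t t R) = A)
    (hAME : A * fromBlocks (kOff Aoo Cof Co) (fromRows Aot Ct) (fromCols Ato Ctf) Att
        * fromBlocks (1 : Matrix (o ⊕ c) (o ⊕ c) R) 0 0 (0 : Matrix t t R) = fromBlocks 1 0 0 0)
    (hEMA : fromBlocks (1 : Matrix (o ⊕ c) (o ⊕ c) R) 0 0 (0 : Matrix t t R)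
        * fromBlocks (kOff Aoo Cof Co) (fromRows Aot Ct) (fromCols Ato Ctf) Att * A = fromBlocks 1 0 0 0) :
    IsUnit (kOff Aoo Cof Co).det
      ∧ (kOff Aoo Cof Co)⁻¹ = A.toBlocks₁₁
      ∧ IsUnit (kBig Aoo Aot Ato Att Cof Ctf Co Ct).det
      ∧ (∀ x y : o ⊕ c, (kBig Aoo Aot Ato Att Cof Ctf Co Ct)⁻¹ (regroup o c t (Sum.inl x)) (regroup o c t (Sum.inl y))
          = A (Sum.inl x) (Sum.inl y)) := by
  have hU := isUnit_det_toBlocks₁₁_of_relInv hEA hAE hAME hEMA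
  have hI := inv_toBlocks₁₁_of_relInv hEA hAE hAME hEMA
  rw [toBlocks_fromBlocks₁₁] at hU hI
  refine ⟨hU, hI, (isUnit_det_kBig_iff Aoo Aot Ato Att Cof Ctf Co Ct).2 hU, fun x y => ?_⟩
  rw [inv_kBig_apply Aoo Aot Ato Att Cof Ctf Co Ct hU, hI]
  rfl

end Sliced

/-! ## §3 The same in the road's `kkt` currency (`Beta.Composition.kkt H Q = fromBlocks H Qᵀ Q 0`, slice rows = comb-coordinate rows) -/

section KKT

open Literature.MathematicalPhysics.QuantumFieldTheory.Balaban1983to89.Beta.Composition (kkt)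
open Summit.QuantumFields.BalabanUV.Beta.SaddleInverse (kBig kOff regroup)

variable {𝕜 : Type*} [Field 𝕜]
variable {o c t : Type*} [Fintype o] [Fintype c] [Fintype t] [DecidableEq o] [DecidableEq c] [DecidableEq t]

omit [Fintype o] [Fintype c] [Fintype t] [DecidableEq o] [DecidableEq c] in
/-- [folklore] The road's SLICED KKT `kkt H [Q; τ]` with fine Hessian `H = [[Aoo, Aot], [Ato, Att]]` (non-comb ⊕ comb bonds), averaging rows
`Q = [Co | Ct]` and the comb-COORDINATE slice rows `τ = [0 | 1]` IS cap3's `kBig` with `C♭ := Cᵀ`. -/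
theorem kkt_fromRows_coordSlice_eq_kBig (Aoo : Matrix o o 𝕜) (Aot : Matrix o t 𝕜) (Ato : Matrix t o 𝕜) (Att : Matrix t t 𝕜)
    (Co : Matrix c o 𝕜) (Ct : Matrix c t 𝕜) :
    kkt (fromBlocks Aoo Aot Ato Att) (fromRows (fromCols Co Ct) (fromCols (0 : Matrix t o 𝕜) (1 : Matrix t t 𝕜)))
      = kBig Aoo Aot Ato Att Coᵀ Ctᵀ Co Ct := by
  ext x y
  rcases x with (i | j) | (a | j) <;> rcases y with (i' | j') | (a' | j')
  all_goals first
    | rfl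
    | simp only [kkt, kBig, fromBlocks_apply₁₂, fromBlocks_apply₂₂, transpose_apply, fromRows_apply_inr, fromCols_apply_inr,
        Matrix.one_apply, eq_comm]

/-- **[folklore] (T-INV), FINITE-DIMENSIONAL FORM, `kkt` CURRENCY**: if `A` (indexed live ⊕ dead = (non-comb bonds ⊕ multipliers) ⊕ comb bonds)
obeys an2's four relative-inverse rules for the bordered Hessian `kkt H Q` (re-indexed live ⊕ dead: `fromBlocks (kOff Aoo Coᵀ Co)
(fromRows Aot Ct) (fromCols Ato Ctᵀ) Att`) w.r.t. the comb-coordinate projector `E = fromBlocks 1 0 0 0`, then the road's sliced KKT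
`kkt H [Q; τ]` (`τ` = comb-coordinate rows) has a unit determinant and the live corner of its inverse is `A`. -/
theorem isUnit_det_kkt_coordSlice_of_relInv (Aoo : Matrix o o 𝕜) (Aot : Matrix o t 𝕜) (Ato : Matrix t o 𝕜) (Att : Matrix t t 𝕜)
    (Co : Matrix c o 𝕜) (Ct : Matrix c t 𝕜) {A : Matrix ((o ⊕ c) ⊕ t) ((o ⊕ c) ⊕ t) 𝕜}
    (hEA : fromBlocks (1 : Matrix (o ⊕ c) (o ⊕ c) 𝕜) 0 0 (0 : Matrix t t 𝕜) * A = A)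
    (hAE : A * fromBlocks (1 : Matrix (o ⊕ c) (o ⊕ c) 𝕜) 0 0 (0 : Matrix t t 𝕜) = A)
    (hAME : A * fromBlocks (kOff Aoo Coᵀ Co) (fromRows Aot Ct) (fromCols Ato Ctᵀ) Att
        * fromBlocks (1 : Matrix (o ⊕ c) (o ⊕ c) 𝕜) 0 0 (0 : Matrix t t 𝕜) = fromBlocks 1 0 0 0)
    (hEMA : fromBlocks (1 : Matrix (o ⊕ c) (o ⊕ c) 𝕜) 0 0 (0 : Matrix t t 𝕜)
        * fromBlocks (kOff Aoo Coᵀ Co) (fromRows Aot Ct) (fromCols Ato Ctᵀ) Att * A = fromBlocks 1 0 0 0) :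
    IsUnit (kkt (fromBlocks Aoo Aot Ato Att) (fromRows (fromCols Co Ct) (fromCols (0 : Matrix t o 𝕜) (1 : Matrix t t 𝕜)))).det
      ∧ ∀ x y : o ⊕ c,
          (kkt (fromBlocks Aoo Aot Ato Att) (fromRows (fromCols Co Ct) (fromCols (0 : Matrix t o 𝕜) (1 : Matrix t t 𝕜))))⁻¹
              (regroup o c t (Sum.inl x)) (regroup o c t (Sum.inl y)) = A (Sum.inl x) (Sum.inl y) := by
  rw [kkt_fromRows_coordSlice_eq_kBig]
  obtain ⟨-, -, h3, h4⟩ := sliced_kkt_of_relInv Aoo Aot Ato Att Coᵀ Ctᵀ Co Ct hEA hAE hAME hEMA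
  exact ⟨h3, h4⟩

end KKT

/-! ## §4 Native indexing: the same through an index equivalence `e : ι ≃ (o ⊕ c) ⊕ t` (v1.1, append-only) -/

section Reindex

open Literature.MathematicalPhysics.QuantumFieldTheory.Balaban1983to89.Beta.Composition (kkt)
open Summit.QuantumFields.BalabanUV.Beta.SaddleInverse (kBig kOff regroup)

variable {𝕜 : Type*} [Field 𝕜]
variable {ι o c t : Type*} [Fintype ι] [Fintype o] [Fintype c] [Fintype t] [DecidableEq o] [DecidableEq c] [DecidableEq t]

/-- [folklore] **NATIVE INDEXING.**  A consumer's matrices live on ONE finite index type `ι` (e.g. periodised bonds ⊕ multipliers); let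
`e : ι ≃ (o ⊕ c) ⊕ t` sort it into (non-comb bonds ⊕ multipliers) ⊕ comb bonds, and let the four relative-inverse rules hold ON `ι` for
`A 𝕄 : Matrix ι ι 𝕜` and the pulled-back projector `E := (fromBlocks 1 0 0 0).submatrix e e`.  If the sorted `𝕄` is the bordered Hessian of
§3 (`reindex e e 𝕄 = fromBlocks (kOff Aoo Coᵀ Co) (fromRows Aot Ct) (fromCols Ato Ctᵀ) Att`), then the road's sliced KKT
`kkt [[Aoo,Aot],[Ato,Att]] [[Co,Ct];[0,1]]` has a unit determinant and the live corner of its inverse is read off `A` through `e`. -/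
theorem isUnit_det_kkt_coordSlice_of_relInv_native (e : ι ≃ (o ⊕ c) ⊕ t) (Aoo : Matrix o o 𝕜) (Aot : Matrix o t 𝕜) (Ato : Matrix t o 𝕜)
    (Att : Matrix t t 𝕜) (Co : Matrix c o 𝕜) (Ct : Matrix c t 𝕜) {A M : Matrix ι ι 𝕜}
    (hM : Matrix.reindex e e M = fromBlocks (kOff Aoo Coᵀ Co) (fromRows Aot Ct) (fromCols Ato Ctᵀ) Att)
    (hEA : (fromBlocks (1 : Matrix (o ⊕ c) (o ⊕ c) 𝕜) 0 0 (0 : Matrix t t 𝕜)).submatrix e e * A = A)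
    (hAE : A * (fromBlocks (1 : Matrix (o ⊕ c) (o ⊕ c) 𝕜) 0 0 (0 : Matrix t t 𝕜)).submatrix e e = A)
    (hAME : A * M * (fromBlocks (1 : Matrix (o ⊕ c) (o ⊕ c) 𝕜) 0 0 (0 : Matrix t t 𝕜)).submatrix e e
      = (fromBlocks (1 : Matrix (o ⊕ c) (o ⊕ c) 𝕜) 0 0 (0 : Matrix t t 𝕜)).submatrix e e)
    (hEMA : (fromBlocks (1 : Matrix (o ⊕ c) (o ⊕ c) 𝕜) 0 0 (0 : Matrix t t 𝕜)).submatrix e e * M * A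
      = (fromBlocks (1 : Matrix (o ⊕ c) (o ⊕ c) 𝕜) 0 0 (0 : Matrix t t 𝕜)).submatrix e e) :
    IsUnit (kkt (fromBlocks Aoo Aot Ato Att) (fromRows (fromCols Co Ct) (fromCols (0 : Matrix t o 𝕜) (1 : Matrix t t 𝕜)))).det
      ∧ ∀ x y : o ⊕ c,
          (kkt (fromBlocks Aoo Aot Ato Att) (fromRows (fromCols Co Ct) (fromCols (0 : Matrix t o 𝕜) (1 : Matrix t t 𝕜))))⁻¹
              (regroup o c t (Sum.inl x)) (regroup o c t (Sum.inl y)) = A (e.symm (Sum.inl x)) (e.symm (Sum.inl y)) := by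
  -- transport the four rules along `e` (`reindex e e X = X.submatrix e.symm e.symm`, multiplicative)
  set E : Matrix ((o ⊕ c) ⊕ t) ((o ⊕ c) ⊕ t) 𝕜 := fromBlocks (1 : Matrix (o ⊕ c) (o ⊕ c) 𝕜) 0 0 (0 : Matrix t t 𝕜) with hE
  have hEe : (E.submatrix e e).submatrix e.symm e.symm = E := by
    ext i j
    simp only [Matrix.submatrix_apply, Equiv.apply_symm_apply]
  have mul_sub : ∀ X Y : Matrix ι ι 𝕜, (X * Y).submatrix e.symm e.symm = X.submatrix e.symm e.symm * Y.submatrix e.symm e.symm :=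
    fun X Y => (Matrix.submatrix_mul_equiv X Y e.symm e.symm e.symm).symm
  have hM' : M.submatrix e.symm e.symm = fromBlocks (kOff Aoo Coᵀ Co) (fromRows Aot Ct) (fromCols Ato Ctᵀ) Att := by
    rw [← hM]; rfl
  have h1 : E * A.submatrix e.symm e.symm = A.submatrix e.symm e.symm := by
    have := congrArg (fun X : Matrix ι ι 𝕜 => X.submatrix e.symm e.symm) hEA
    simpa only [mul_sub, hEe] using this
  have h2 : A.submatrix e.symm e.symm * E = A.submatrix e.symm e.symm := by
    have := congrArg (fun X : Matrix ι ι 𝕜 => X.submatrix e.symm e.symm) hAE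
    simpa only [mul_sub, hEe] using this
  have h3 : A.submatrix e.symm e.symm * fromBlocks (kOff Aoo Coᵀ Co) (fromRows Aot Ct) (fromCols Ato Ctᵀ) Att * E = E := by
    have := congrArg (fun X : Matrix ι ι 𝕜 => X.submatrix e.symm e.symm) hAME
    simpa only [mul_sub, hEe, hM'] using this
  have h4 : E * fromBlocks (kOff Aoo Coᵀ Co) (fromRows Aot Ct) (fromCols Ato Ctᵀ) Att * A.submatrix e.symm e.symm = E := by
    have := congrArg (fun X : Matrix ι ι 𝕜 => X.submatrix e.symm e.symm) hEMA
    simpa only [mul_sub, hEe, hM'] using this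
  obtain ⟨hu, hc⟩ := isUnit_det_kkt_coordSlice_of_relInv Aoo Aot Ato Att Co Ct (A := A.submatrix e.symm e.symm) h1 h2 h3 h4
  exact ⟨hu, fun x y => by rw [hc x y]; rfl⟩

end Reindex

/-! ## §4b Native indexing with FREE border letters (signed placements `[[H, Qᵀ],[−Q, 0]]` allowed) (v1.2, append-only) -/

section ReindexSigned

open Summit.QuantumFields.BalabanUV.Beta.SaddleInverse (kBig kOff regroup)

variable {R : Type*} [CommRing R]
variable {ι o c t : Type*} [Fintype ι] [Fintype o] [Fintype c] [Fintype t] [DecidableEq o] [DecidableEq c] [DecidableEq t]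

/-- [folklore] `sliced_kkt_of_relInv` through an index equivalence `e : ι ≃ (o ⊕ c) ⊕ t`, border letters free (signed placements allowed). -/
theorem sliced_kkt_of_relInv_native (e : ι ≃ (o ⊕ c) ⊕ t) (Aoo : Matrix o o R) (Aot : Matrix o t R) (Ato : Matrix t o R) (Att : Matrix t t R)
    (Cof : Matrix o c R) (Ctf : Matrix t c R) (Co : Matrix c o R) (Ct : Matrix c t R) {A M : Matrix ι ι R}
    (hM : Matrix.reindex e e M = fromBlocks (kOff Aoo Cof Co) (fromRows Aot Ct) (fromCols Ato Ctf) Att)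
    (hEA : (fromBlocks (1 : Matrix (o ⊕ c) (o ⊕ c) R) 0 0 (0 : Matrix t t R)).submatrix e e * A = A)
    (hAE : A * (fromBlocks (1 : Matrix (o ⊕ c) (o ⊕ c) R) 0 0 (0 : Matrix t t R)).submatrix e e = A)
    (hAME : A * M * (fromBlocks (1 : Matrix (o ⊕ c) (o ⊕ c) R) 0 0 (0 : Matrix t t R)).submatrix e e
      = (fromBlocks (1 : Matrix (o ⊕ c) (o ⊕ c) R) 0 0 (0 : Matrix t t R)).submatrix e e)
    (hEMA : (fromBlocks (1 : Matrix (o ⊕ c) (o ⊕ c) R) 0 0 (0 : Matrix t t R)).submatrix e e * M * A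
      = (fromBlocks (1 : Matrix (o ⊕ c) (o ⊕ c) R) 0 0 (0 : Matrix t t R)).submatrix e e) :
    IsUnit (kOff Aoo Cof Co).det
      ∧ IsUnit (kBig Aoo Aot Ato Att Cof Ctf Co Ct).det
      ∧ ∀ x y : o ⊕ c, (kBig Aoo Aot Ato Att Cof Ctf Co Ct)⁻¹ (regroup o c t (Sum.inl x)) (regroup o c t (Sum.inl y))
          = A (e.symm (Sum.inl x)) (e.symm (Sum.inl y)) := by
  set E : Matrix ((o ⊕ c) ⊕ t) ((o ⊕ c) ⊕ t) R := fromBlocks (1 : Matrix (o ⊕ c) (o ⊕ c) R) 0 0 (0 : Matrix t t R) with hE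
  have hEe : (E.submatrix e e).submatrix e.symm e.symm = E := by
    ext i j
    simp only [Matrix.submatrix_apply, Equiv.apply_symm_apply]
  have mul_sub : ∀ X Y : Matrix ι ι R, (X * Y).submatrix e.symm e.symm = X.submatrix e.symm e.symm * Y.submatrix e.symm e.symm :=
    fun X Y => (Matrix.submatrix_mul_equiv X Y e.symm e.symm e.symm).symm
  have hM' : M.submatrix e.symm e.symm = fromBlocks (kOff Aoo Cof Co) (fromRows Aot Ct) (fromCols Ato Ctf) Att := by
    rw [← hM]; rfl
  have h1 : E * A.submatrix e.symm e.symm = A.submatrix e.symm e.symm := by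
    have := congrArg (fun X : Matrix ι ι R => X.submatrix e.symm e.symm) hEA
    simpa only [mul_sub, hEe] using this
  have h2 : A.submatrix e.symm e.symm * E = A.submatrix e.symm e.symm := by
    have := congrArg (fun X : Matrix ι ι R => X.submatrix e.symm e.symm) hAE
    simpa only [mul_sub, hEe] using this
  have h3 : A.submatrix e.symm e.symm * fromBlocks (kOff Aoo Cof Co) (fromRows Aot Ct) (fromCols Ato Ctf) Att * E = E := by
    have := congrArg (fun X : Matrix ι ι R => X.submatrix e.symm e.symm) hAME
    simpa only [mul_sub, hEe, hM'] using this
  have h4 : E * fromBlocks (kOff Aoo Cof Co) (fromRows Aot Ct) (fromCols Ato Ctf) Att * A.submatrix e.symm e.symm = E := by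
    have := congrArg (fun X : Matrix ι ι R => X.submatrix e.symm e.symm) hEMA
    simpa only [mul_sub, hEe, hM'] using this
  obtain ⟨hu, -, hk, hc⟩ := sliced_kkt_of_relInv Aoo Aot Ato Att Cof Ctf Co Ct (A := A.submatrix e.symm e.symm) h1 h2 h3 h4
  exact ⟨hu, hk, fun x y => by rw [hc x y]; rfl⟩

end ReindexSigned

end Summit.QuantumFields.BalabanUV.Beta.FP.RelInvCompression
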